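/-
Copyright (c) 2026. All rights reserved.
Released under Apache 2.0 license as described in the file LICENSE.
Authors: abc-iut cell, prover seat abc-iut-f-102 (F fact-proving wave, gen 3).
-/
import Literature.AnabelianGeometry.AbsoluteAnabelian.LogFrobeniusRealisesSufficiency
import Literature.AnabelianGeometry.AbsoluteAnabelian.LogFrobeniusRealisesNecessity
import Literature.AnabelianGeometry.AbsoluteAnabelian.LogFrobeniusShiftActionNecessity
import HarnessLib

/-!
# [AbsTopIII] Cor 5.5 (i)/(iii)/(v): THEOREM B — F-0159 / F-0157 / F-0156 decided at every setting (the equivalence)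

S. Mochizuki, *Topics in absolute anabelian geometry III: global reconstruction algorithms*,
J. Math. Sci. Univ. Tokyo 22 (2015) 939–1156 [MochizukiAbsTopIII2015]; locators `p.N` = pages of the author's
manuscript (`paper:url-5493eb38cbb7`), read on the page: Cor 5.5 (i) p. 130, (iii) p. 131, (v) pp. 131–133.

THEOREM B of the f-102 lineage assembled (sufficiency `LogFrobeniusRealisesSufficiency`, necessity
`LogFrobeniusRealisesNecessity`, abc-iut-f-101's `cor55Observables_iff_iotaSquaresCommute`, gen 2's THEOREM A): over the
interface `LogFrobeniusSetting`, the FACT-LIST rows F-0159 (`RealisesCor55Families`, ∃-form), F-0157 (`Cor55ShiftAction`) and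
F-0156 (`Cor55Rigidity`) are each EQUIVALENT to an explicit interface-level condition: the index set `V(F_mod)` is nonempty,
the `ι⊞`-squares of every `Γ⃗^log_v` commute (Def 5.4 (iii)), and the `ι⊞_{v,ε}` lie over `Th•[Z]` with respect to SOME
over-data `A_ν : λ⊞_{v,ν} ⋙ (𝒩⊞_v → ℰ•) ≅ proj`, `Ξ : log ⋙ proj ≅ proj` (for F-0156: and `𝒳 = Th•_T[Z]` is id-rigid).  In
print all three conditions hold (Def 5.4 (iii), (iv), (ii)); the interface records the over-structure for `λ⊞` and `log`
(`lamOver`, `logOver`) but not for `ι⊞` — which is exactly what the rows add as assumptions on `L`.  No side taken; a FACT row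
is an assumption label; refereed pre-IUT material; nothing here bears on [IUTchIII] Cor. 3.12; typed ≠ proved.
-/

set_option autoImplicit false

universe u

open CategoryTheory Quiver

namespace Literature.AnabelianGeometry.AbsoluteAnabelian

namespace LogFrobeniusSetting

variable {Vmod : Type u} {isArc : Vmod → Bool} (L : LogFrobeniusSetting Vmod isArc)

/-- **THEOREM B (F-0159 decided at every setting).**  Some family of homotopies on `D•⊢` realises the cores of Cor 5.5 (i)
and the observables `S_log⊞_v` of Cor 5.5 (iii) IF AND ONLY IF `V(F_mod) ≠ ∅`, the `ι⊞`-squares commute at every place, and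
the `ι⊞_{v,ε}` lie over `Th•[Z]` with respect to some over-data `A`, `Ξ`.
[cite: MochizukiAbsTopIII2015, Cor 5.5 (iii) p. 131] -/
theorem exists_realisesCor55Families_iff :
    (∃ K : L.diagram.HomotopyFamily, L.RealisesCor55Families K) ↔
      Nonempty Vmod ∧ (∀ v, L.IotaSquaresCommute v) ∧
        ∃ (A : ∀ (v : Vmod) (ν : LogVertex (isArc v)), ν.isPostLog = false →
            (L.lam v ν ⋙ L.forget v ⋙ L.toE v ≅ L.proj)) (Ξ : L.log ⋙ L.proj ≅ L.proj),
          (∀ (v : Vmod) (ν₁ ν₂ : LogVertex (isArc v)) (ε : LogEdge (isArc v) ν₁ ν₂) (h₁ : ν₁.isPostLog = false)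
            (h₂ : ν₂.isPostLog = false) (X₀ : L.X), (L.toE v).map ((L.forget v).map ((L.iota v ε).app X₀)) ≍
            ((A v ν₁ h₁).hom.app X₀ ≫ (A v ν₂ h₂).inv.app X₀)) ∧
          (∀ (v : Vmod) (ν₁ ν₂ : LogVertex (isArc v)) (ε : LogEdge (isArc v) ν₁ ν₂) (_ : ν₁.isPostLog = true)
            (h₂ : ν₂.isPostLog = false) (hsl : (LogVertex.spaceLink (isArc v)).isPostLog = false) (X₀ : L.X),
            (L.toE v).map ((L.forget v).map ((L.iota v ε).app X₀)) ≍
            ((A v _ hsl).hom.app (L.log.obj X₀) ≫ Ξ.hom.app X₀ ≫ (A v ν₂ h₂).inv.app X₀)) := by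
  constructor
  · rintro ⟨K, hK⟩
    exact ⟨L.nonempty_of_realisesCor55Families hK,
      L.cor55Observables_iff_iotaSquaresCommute.mp (L.cor55Observables_of_realisesCor55Families hK),
      L.exists_over_of_realisesCor55Families hK⟩
  · rintro ⟨⟨v₀⟩, hsq, A, Ξ, hpre, hpost⟩
    haveI : Nonempty Vmod := ⟨v₀⟩
    exact L.exists_realisesCor55Families_of_over A Ξ hsq hpre hpost

/-- **F-0157 decided at every setting**: the `ℤ`-action clause of Cor 5.5 (v) (`Cor55ShiftAction`) holds iff the same
condition holds (gen 2's THEOREM A `cor55ShiftAction_iff_exists_realisesCor55Families`).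
[cite: MochizukiAbsTopIII2015, Cor 5.5 (v) pp. 131–133] -/
theorem cor55ShiftAction_iff_over :
    L.Cor55ShiftAction ↔
      Nonempty Vmod ∧ (∀ v, L.IotaSquaresCommute v) ∧
        ∃ (A : ∀ (v : Vmod) (ν : LogVertex (isArc v)), ν.isPostLog = false →
            (L.lam v ν ⋙ L.forget v ⋙ L.toE v ≅ L.proj)) (Ξ : L.log ⋙ L.proj ≅ L.proj),
          (∀ (v : Vmod) (ν₁ ν₂ : LogVertex (isArc v)) (ε : LogEdge (isArc v) ν₁ ν₂) (h₁ : ν₁.isPostLog = false)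
            (h₂ : ν₂.isPostLog = false) (X₀ : L.X), (L.toE v).map ((L.forget v).map ((L.iota v ε).app X₀)) ≍
            ((A v ν₁ h₁).hom.app X₀ ≫ (A v ν₂ h₂).inv.app X₀)) ∧
          (∀ (v : Vmod) (ν₁ ν₂ : LogVertex (isArc v)) (ε : LogEdge (isArc v) ν₁ ν₂) (_ : ν₁.isPostLog = true)
            (h₂ : ν₂.isPostLog = false) (hsl : (LogVertex.spaceLink (isArc v)).isPostLog = false) (X₀ : L.X),
            (L.toE v).map ((L.forget v).map ((L.iota v ε).app X₀)) ≍
            ((A v _ hsl).hom.app (L.log.obj X₀) ≫ Ξ.hom.app X₀ ≫ (A v ν₂ h₂).inv.app X₀)) :=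
  L.cor55ShiftAction_iff_exists_realisesCor55Families.trans L.exists_realisesCor55Families_iff

/-- **F-0156 decided at every setting**: Cor 5.5 (v) as one node (`Cor55Rigidity`) holds iff `𝒳 = Th•_T[Z]` is id-rigid and
the same condition holds. [cite: MochizukiAbsTopIII2015, Cor 5.5 (v) pp. 131–133] -/
theorem cor55Rigidity_iff_over :
    L.Cor55Rigidity ↔ IsIdRigid L.X ∧
      (Nonempty Vmod ∧ (∀ v, L.IotaSquaresCommute v) ∧
        ∃ (A : ∀ (v : Vmod) (ν : LogVertex (isArc v)), ν.isPostLog = false →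
            (L.lam v ν ⋙ L.forget v ⋙ L.toE v ≅ L.proj)) (Ξ : L.log ⋙ L.proj ≅ L.proj),
          (∀ (v : Vmod) (ν₁ ν₂ : LogVertex (isArc v)) (ε : LogEdge (isArc v) ν₁ ν₂) (h₁ : ν₁.isPostLog = false)
            (h₂ : ν₂.isPostLog = false) (X₀ : L.X), (L.toE v).map ((L.forget v).map ((L.iota v ε).app X₀)) ≍
            ((A v ν₁ h₁).hom.app X₀ ≫ (A v ν₂ h₂).inv.app X₀)) ∧
          (∀ (v : Vmod) (ν₁ ν₂ : LogVertex (isArc v)) (ε : LogEdge (isArc v) ν₁ ν₂) (_ : ν₁.isPostLog = true)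
            (h₂ : ν₂.isPostLog = false) (hsl : (LogVertex.spaceLink (isArc v)).isPostLog = false) (X₀ : L.X),
            (L.toE v).map ((L.forget v).map ((L.iota v ε).app X₀)) ≍
            ((A v _ hsl).hom.app (L.log.obj X₀) ≫ Ξ.hom.app X₀ ≫ (A v ν₂ h₂).inv.app X₀))) :=
  L.cor55Rigidity_iff_isIdRigid_and_exists.trans (and_congr Iff.rfl L.exists_realisesCor55Families_iff)

end LogFrobeniusSetting

end Literature.AnabelianGeometry.AbsoluteAnabelian
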